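import Summits.CriticalPhenomena.Ising3DConformalLimit.Theorems.ArmDressingArmDressingGlueInvDefs
import Summits.CriticalPhenomena.Ising3DConformalLimit.Theorems.ArmDressingArmDressingGlueInvSystems
import Summits.CriticalPhenomena.Ising3DConformalLimit.Theorems.ArmDressingArmDressingGlueInvVSandwich
import HarnessLib

/-!
# Crux `ArmDressingGlue` (stmt-CriticalPhenomena-15700), stub 3' — part 4b: the arm factor `v` picks up the
# weight `∏ ‖z_j‖^{2Δ}` under the unit inversion (limit algebra)

Camia–Feng §3.2.3 transposed, second half, real-analysis side.  Abstract inputs (all produced by parts 1–4a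
for the system `Σ = (z, r, z, 1)` and its inversion image `Σ*`):

* the sandwich `W(η(1-ε)) ≤ W*(η) ≤ W(η(1+ε))` eventually in `η`, for every `0 < ε < 1` (part 4a);
* the C(ii) limits `W(η)/∏ⱼ w(η) → v` and `W*(η)/∏ⱼ w*(η bⱼ) → v*`, `bⱼ = ‖zⱼ‖⁻²`, with `w* = w` near `0⁺`;
* the one-arm scaling `w(ηκ)/w(η) → κ^Δ` of the one-point witness (part 3) and `w > 0` near `0⁺`.

Output (`vStar_eq_weight_mul`): `v* = (∏ⱼ ‖zⱼ‖^{2Δ}) · v` — since `W(η(1±ε))/∏ⱼ w(η bⱼ) =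
[W(η(1±ε))/w(η(1±ε))ⁿ] · ∏ⱼ [w(η(1±ε))/w(η bⱼ)] → v · ∏ⱼ ((1±ε)/bⱼ)^Δ`, the squeezed middle term tends to `v*`,
and `ε → 0`.  Also here: witnesses of the one-point clause are eventually positive (`cOne_eventually_pos`).

Registered bookkeeping stub proved here: `stub_invVTransport`.  No definitions, no named facts, no sorry.

Reference: F. Camia, Y. Feng, arXiv:2411.01467, §3.2.3 (terms `T₃`, `T₄`, eqs. (cov_aux2)–(cov_aux3)).
-/

noncomputable section

namespace Summit.CriticalPhenomena.Ising3DConformalLimit.Cruxes.ArmDressingGlue.InvBook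

open scoped BigOperators Topology
open Filter Set Metric
open Literature.Probability.LatticeModels Literature.Probability.Percolation
open Literature.Barriers.CriticalPhenomena
open Summit.CriticalPhenomena.Ising3DConformalLimit.Theses
open Summit.CriticalPhenomena.Ising3DConformalLimit.Cruxes.ArmDressingGlue.Vocab

/-! ### One-point witnesses are eventually positive -/

/-- The two members of the one-point family are finite, resp. co-finite (`δ > 0`). [folklore] -/
theorem pair_finite_or_cofinite {δ : ℝ} (hδ : 0 < δ) (c : EuclideanSpace ℝ (Fin 3)) (ρ R : ℝ) :
    ∀ i, ((![disc δ (closedBall c ρ), disc δ (ball (0 : EuclideanSpace ℝ (Fin 3)) R)ᶜ] :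
      Fin 2 → Set (Site 3)) i).Finite ∨
      ((![disc δ (closedBall c ρ), disc δ (ball (0 : EuclideanSpace ℝ (Fin 3)) R)ᶜ] :
        Fin 2 → Set (Site 3)) i)ᶜ.Finite := by
  intro i
  fin_cases i
  · exact Or.inl (finite_disc hδ isBounded_closedBall)
  · exact Or.inr (cofinite_disc_compl hδ isBounded_ball)

/-- A witness of the one-point clause of crux C is eventually non-negative (its values are limits of limits of
ratios of probabilities). [folklore] -/
theorem cOne_eventually_nonneg {w : ℝ → ℝ} (hw : COne w) : ∀ᶠ η in 𝓝[>] (0:ℝ), 0 ≤ w η := by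
  have hadm : ∀ᶠ η' in 𝓝[>] (0:ℝ), 0 < η' ∧
      (0 : EuclideanSpace ℝ (Fin 3)) ∈ ball (0 : EuclideanSpace ℝ (Fin 3)) (η' / 2) := by
    filter_upwards [self_mem_nhdsWithin] with η hη using ⟨hη, mem_ball_self (half_pos hη)⟩
  have h1 := hw (fun _ => 0) (fun η => η) (tendsto_nhdsWithin_of_tendsto_nhds tendsto_id) hadm
  filter_upwards [h1] with η hη
  obtain ⟨Λ, hΛ, hΛw⟩ := hη
  refine ge_of_tendsto hΛw (hΛ.mono fun η' h => ge_of_tendsto h ?_)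
  filter_upwards [self_mem_nhdsWithin] with δ hδ
  exact div_nonneg (Pr_mem_Icc (pair_finite_or_cofinite hδ _ _ _) _).1
    (Pr_mem_Icc (pair_finite_or_cofinite hδ _ _ _) _).1

/-- … and eventually POSITIVE as soon as it has the one-arm scaling (at one scale factor). [folklore] -/
theorem cOne_eventually_pos {w : ℝ → ℝ} {Δ : ℝ} (hw : COne w)
    (h2 : Tendsto (fun η => w (η * 2) / w η) (𝓝[>] 0) (𝓝 ((2:ℝ) ^ Δ))) :
    ∀ᶠ η in 𝓝[>] (0:ℝ), 0 < w η := by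
  have hne : ∀ᶠ η in 𝓝[>] (0:ℝ), w (η * 2) / w η ≠ 0 :=
    h2.eventually_ne (Real.rpow_pos_of_pos two_pos Δ).ne'
  filter_upwards [cOne_eventually_nonneg hw, hne] with η h0 h1
  exact lt_of_le_of_ne h0 fun h => h1 (by rw [← h, div_zero])

/-! ### The limit algebra -/

/-- The limit of the comparison functions: `W(ηs)/∏ⱼ w(η bⱼ) → v · ∏ⱼ (s/bⱼ)^Δ` (`s > 0`), from
`W(η)/∏ⱼ w(η) → v`, the scaling of `w`, and `w > 0` near `0⁺`. [cite: CamiaFeng2025, §3.2.3] -/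
theorem tendsto_comparison {n : ℕ} {b : Fin n → ℝ} (hb : ∀ j, 0 < b j) {Δ v : ℝ} {W w : ℝ → ℝ}
    (hT : Tendsto (fun η => W η / ∏ _j : Fin n, w (η * 1)) (𝓝[>] 0) (𝓝 v))
    (hwsc : ∀ κ : ℝ, 0 < κ → Tendsto (fun η => w (η * κ) / w η) (𝓝[>] 0) (𝓝 (κ ^ Δ)))
    (hwpos : ∀ᶠ η in 𝓝[>] (0:ℝ), 0 < w η) {s : ℝ} (hs : 0 < s) :
    Tendsto (fun η => W (η * s) / ∏ j, w (η * b j)) (𝓝[>] 0) (𝓝 (v * ∏ j, (s / b j) ^ Δ)) := by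
  -- first factor: `W(ηs)/w(ηs)ⁿ → v`
  have h1 : Tendsto (fun η => W (η * s) / w (η * s) ^ n) (𝓝[>] 0) (𝓝 v) := by
    have := hT.comp (tendsto_mul_const_nhdsGT hs)
    refine this.congr fun η => ?_
    simp only [Function.comp_apply, mul_one, Finset.prod_const, Finset.card_univ, Fintype.card_fin]
  -- second factor: `∏ⱼ w(ηs)/w(η bⱼ) → ∏ⱼ (s/bⱼ)^Δ`
  have h2 : ∀ j, Tendsto (fun η => w (η * s) / w (η * b j)) (𝓝[>] 0) (𝓝 ((s / b j) ^ Δ)) := by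
    intro j
    have := (hwsc (s / b j) (div_pos hs (hb j))).comp (tendsto_mul_const_nhdsGT (hb j))
    refine this.congr fun η => ?_
    simp only [Function.comp_apply]
    rw [mul_assoc, mul_div_cancel₀ _ (hb j).ne']
  have h3 : Tendsto (fun η => ∏ j, w (η * s) / w (η * b j)) (𝓝[>] 0) (𝓝 (∏ j, (s / b j) ^ Δ)) :=
    tendsto_finsetProd _ fun j _ => h2 j
  -- positivity of the `w`'s involved, eventually
  have hpos_s : ∀ᶠ η in 𝓝[>] (0:ℝ), 0 < w (η * s) := (tendsto_mul_const_nhdsGT hs).eventually hwpos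
  have hpos_b : ∀ᶠ η in 𝓝[>] (0:ℝ), ∀ j, 0 < w (η * b j) :=
    eventually_all.2 fun j => (tendsto_mul_const_nhdsGT (hb j)).eventually hwpos
  refine (h1.mul h3).congr' ?_
  filter_upwards [hpos_s, hpos_b] with η hws hwb
  have hg : ∏ j, w (η * b j) ≠ 0 := Finset.prod_ne_zero_iff.2 fun j _ => (hwb j).ne'
  rw [Finset.prod_div_distrib, Finset.prod_const, Finset.card_univ, Fintype.card_fin,
    div_mul_div_comm, mul_comm (W (η * s)), mul_div_mul_left _ _ (pow_ne_zero n hws.ne')]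

/-- **The arm factor picks up the weight** (Camia–Feng §3.2.3, `T₃ = ∏|φ'(z_j)|^{-1/8}` transposed): from the
sandwich, the two C(ii) limits, the agreement of the one-point witnesses, the one-arm scaling and positivity,
`v* = (∏ⱼ ‖zⱼ‖^{2Δ}) · v`. [cite: CamiaFeng2025, §3.2.3] -/
theorem vStar_eq_weight_mul {n : ℕ} {z : Fin n → EuclideanSpace ℝ (Fin 3)} (hz : ∀ j, z j ≠ 0) {Δ v vs : ℝ}
    {W Ws w ws : ℝ → ℝ}
    (hsand : ∀ ε : ℝ, 0 < ε → ε < 1 → ∀ᶠ η in 𝓝[>] (0:ℝ), W (η * (1 - ε)) ≤ Ws η ∧ Ws η ≤ W (η * (1 + ε)))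
    (hT : Tendsto (fun η => W η / ∏ _j : Fin n, w (η * 1)) (𝓝[>] 0) (𝓝 v))
    (hTs : Tendsto (fun η => Ws η / ∏ j, ws (η * (‖z j‖ ^ 2)⁻¹)) (𝓝[>] 0) (𝓝 vs))
    (hww : ws =ᶠ[𝓝[>] 0] w)
    (hwsc : ∀ κ : ℝ, 0 < κ → Tendsto (fun η => w (η * κ) / w η) (𝓝[>] 0) (𝓝 (κ ^ Δ)))
    (hwpos : ∀ᶠ η in 𝓝[>] (0:ℝ), 0 < w η) :
    vs = (∏ j, ‖z j‖ ^ (2 * Δ)) * v := by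
  set b : Fin n → ℝ := fun j => (‖z j‖ ^ 2)⁻¹ with hb
  have hbpos : ∀ j, 0 < b j := fun j => inv_pos.2 (pow_pos (norm_pos_iff.2 (hz j)) 2)
  -- the starred limit with `w` in place of `w*`
  have hTs' : Tendsto (fun η => Ws η / ∏ j, w (η * b j)) (𝓝[>] 0) (𝓝 vs) := by
    have hev : ∀ᶠ η in 𝓝[>] (0:ℝ), ∀ j, ws (η * b j) = w (η * b j) :=
      eventually_all.2 fun j => (tendsto_mul_const_nhdsGT (hbpos j)).eventually hww
    refine hTs.congr' ?_
    filter_upwards [hev] with η hη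
    exact congrArg (fun x => Ws η / x) (Finset.prod_congr rfl fun j _ => hη j)
  have hgpos : ∀ᶠ η in 𝓝[>] (0:ℝ), 0 < ∏ j, w (η * b j) := by
    have : ∀ᶠ η in 𝓝[>] (0:ℝ), ∀ j, 0 < w (η * b j) :=
      eventually_all.2 fun j => (tendsto_mul_const_nhdsGT (hbpos j)).eventually hwpos
    exact this.mono fun η h => Finset.prod_pos fun j _ => h j
  -- for each `ε`: `v ∏ ((1-ε)/bⱼ)^Δ ≤ v* ≤ v ∏ ((1+ε)/bⱼ)^Δ`
  have hbounds : ∀ ε : ℝ, 0 < ε → ε < 1 →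
      v * ∏ j, ((1 - ε) / b j) ^ Δ ≤ vs ∧ vs ≤ v * ∏ j, ((1 + ε) / b j) ^ Δ := by
    intro ε hε hε1
    have hU := tendsto_comparison hbpos hT hwsc hwpos (s := 1 + ε) (by linarith)
    have hL := tendsto_comparison hbpos hT hwsc hwpos (s := 1 - ε) (by linarith)
    have hev := hsand ε hε hε1
    constructor
    · refine le_of_tendsto_of_tendsto hL hTs' ?_
      filter_upwards [hev, hgpos] with η h hg
      exact div_le_div_of_nonneg_right h.1 hg.le
    · refine le_of_tendsto_of_tendsto hTs' hU ?_
      filter_upwards [hev, hgpos] with η h hg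
      exact div_le_div_of_nonneg_right h.2 hg.le
  -- `ε → 0⁺`
  have hcont : ∀ σ : ℝ, Tendsto (fun ε : ℝ => v * ∏ j, ((1 + σ * ε) / b j) ^ Δ) (𝓝[>] 0)
      (𝓝 (v * ∏ j, (1 / b j) ^ Δ)) := by
    intro σ
    refine Tendsto.const_mul v (tendsto_finsetProd _ fun j _ => ?_)
    have h1 : Tendsto (fun ε : ℝ => (1 + σ * ε) / b j) (𝓝 0) (𝓝 ((1 + σ * 0) / b j)) :=
      ((tendsto_const_nhds.add (tendsto_const_nhds.mul tendsto_id)).div_const _)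
    rw [mul_zero, add_zero] at h1
    exact (h1.mono_left nhdsWithin_le_nhds).rpow_const (Or.inl (div_pos one_pos (hbpos j)).ne')
  have hup : vs ≤ v * ∏ j, (1 / b j) ^ Δ := by
    refine ge_of_tendsto (hcont 1) ?_
    filter_upwards [Ioo_mem_nhdsGT one_pos] with ε hε
    have := (hbounds ε hε.1 hε.2).2
    simpa only [one_mul] using this
  have hdown : v * ∏ j, (1 / b j) ^ Δ ≤ vs := by
    refine le_of_tendsto (hcont (-1)) ?_
    filter_upwards [Ioo_mem_nhdsGT one_pos] with ε hε
    have := (hbounds ε hε.1 hε.2).1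
    simpa only [neg_one_mul, ← sub_eq_add_neg] using this
  have heq : vs = v * ∏ j, (1 / b j) ^ Δ := le_antisymm hup hdown
  rw [heq, mul_comm]
  congr 1
  refine Finset.prod_congr rfl fun j _ => ?_
  rw [hb]
  simp only [one_div, inv_inv]
  rw [Real.rpow_mul (norm_nonneg _), Real.rpow_two]

/-- Registered bookkeeping stub `stub_invVTransport` of the skeleton (= `vStar_eq_weight_mul`), through which this
file lands. [cite: CamiaFeng2025, §3.2.3] -/
theorem stub_invVTransport : ∀ (n : ℕ) (z : Fin n → EuclideanSpace ℝ (Fin 3)), (∀ j, z j ≠ 0) → ∀ (Δ v vs : ℝ) (W Ws w ws : ℝ → ℝ), (∀ ε : ℝ, 0 < ε → ε < 1 → ∀ᶠ η in 𝓝[>] (0:ℝ), W (η * (1 - ε)) ≤ Ws η ∧ Ws η ≤ W (η * (1 + ε))) → Tendsto (fun η => W η / ∏ _j : Fin n, w (η * 1)) (𝓝[>] 0) (𝓝 v) → Tendsto (fun η => Ws η / ∏ j, ws (η * (‖z j‖ ^ 2)⁻¹)) (𝓝[>] 0) (𝓝 vs) → ws =ᶠ[𝓝[>] 0] w → (∀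 κ : ℝ, 0 < κ → Tendsto (fun η => w (η * κ) / w η) (𝓝[>] 0) (𝓝 (κ ^ Δ))) → (∀ᶠ η in 𝓝[>] (0:ℝ), 0 < w η) → vs = (∏ j, ‖z j‖ ^ (2 * Δ)) * v :=
  fun _ _ hz _ _ _ _ _ _ _ hsand hT hTs hww hwsc hwpos => vStar_eq_weight_mul hz hsand hT hTs hww hwsc hwpos

end Summit.CriticalPhenomena.Ising3DConformalLimit.Cruxes.ArmDressingGlue.InvBook

end
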